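import Summits.QuantumFields.YangMills.Theorems.BalabanUVNodesN14ConvexFibreConsistency
import Summits.QuantumFields.YangMills.Theorems.BalabanUVNodesN14LawChannelTunedPathToy
import Literature.Barriers.HubbardSuperconductivity.WeakCouplingCeiling

/-!
# DAG node N14 · NE1′ — THE SHARP TILT-DEFECT CONSTANT under N14's binder: a log-density tilt `|g| ≤ δ` of a probability law moves the
# mean of a `B`-bounded observable by at most `2B·tanh(δ∕2)` (≤ `B·δ`) and every set mass by at most `tanh(δ∕2)` — ATTAINED on a two-point law

Cell `pub-ymgap`, YM-PLAN Track A (HUMAN RULING D-0062 ∕ D-0149, director-ym №197), width seat `pub-ymgap-dag-n14-w3` (generation 2).  Row n14's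
three START-LIST items are DELIVERED (w1 ∕ w2 ∕ w3 g0); N14 is carried DEPENDENT on §N19 s1 ∕ U3 (director-ym №195 (8): «U3 ⇒ SHAPE_cl ⇒ N14's
binder for every unit-scale observable», n19-c p496221 :258 ∕ n19-e p497552 :280) — this is a free-capacity item ON THAT DEPENDENCY CHAIN.  THEOREMS
ONLY (0 `def`); imports n14-c J `…N14ConvexFibreConsistency` (the lemma sharpened; through it gaps-ne1 `Spine/NE1p/DressedMGFForm.tiltedMean`), n14-c's
decided toy `…N14LawChannelTunedPathToy` (`integral_spin_tilted`, for the witness) and the barrier catalogue's `…/HubbardSuperconductivity/WeakCouplingCeiling`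
(`tanh_le_self`, `tanh_nonneg`) — cited BY NAME; edits nothing; `--supports` K3⁷ `SpineGivenEndpointR13SepCoPH` (stmt-QuantumFields-20544) `--as helper`,
COUNT-NEUTRAL.  The chain's editions (n19-c's `tiltedMeanMatching_of_shapeDensity` ∕ `tvSandwich_of_shapeSandwich` at the sharp ∕ linear rates) are the
sibling `…N14SharpTiltDefectChain`.

THE POINT.  Every «SHAPE_cl ⇒ (I)-binder» step of the N19 → N14 chain runs on ONE engine: a tilt `g`, `|g| ≤ δ`, of a probability law `μ` moves the
mean of a `B`-bounded `F` by at most `C(δ)·B`.  The tree books `C(δ) = e^{2δ} − 1` (n14-c J `ConvexFibreConsistency.abs_tiltedMean_tilted_sub_le`, consumed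
by n19-c `N19ClassSandwichRoad.tiltedMeanMatching_of_shapeDensity`, n19-w2's U3 face for N14 `…N19ShapeFaceN14AtRecord`, n19-d M27
`…N19DensityRoad.tiltedMeanMatching_of_vacuumDens`) and SHAPE_cl(`r`) ⇒ TV_cl at `e^{2r} − 1` (n19-c `N19CoreTVInvariant.tvSandwich_of_shapeSandwich`).  THE
SHARP VALUES are `C(δ) = 2·tanh(δ∕2)` and TV ≤ `tanh(r∕2)`: the density `ρ = e^{g}∕∫e^{g}dμ` lies in `[a, a·e^{2δ}] ∋ 1`, `(ρ − 1)₊` lies under the chord,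
whose integral `(1 − a)(ae^{2δ} − 1)∕(ae^{2δ} − a)` peaks at `a = e^{−δ}` with value `(e^{δ} − 1)∕(e^{δ} + 1) = tanh(δ∕2)`; for set masses the two-set
sandwich bounds the ODDS RATIO by `e^{2r}`, whence `tanh(r∕2)`.  Both are ATTAINED (§3).  So: factor `2` (means) ∕ `4` (sets) at small widths, BOUNDED
(`≤ 2B`, `≤ 1`) at large ones, and a LINEAR rate `η_K = B·r_K` for N14's binder (`Summable r ⇒ Summable η` by `Summable.mul_left`).

* §1 [folklore, reals] `abs_sub_one_le_chord` · `chord_value_le` · `tanh_half_eq_exp` · `tanh_half_nonneg` · `two_mul_tanh_half_le_exp_two_mul_sub_one`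
  (the sharp constant implies the tree's).  (The odds-ratio half — set masses from a two-set sandwich — is in the sibling `…Chain`.)
* §2 [folklore, one probability law] `exp_neg_le_integral_exp_le` · ★ `integral_abs_density_sub_one_le` (`∫|ρ − 1|dμ ≤ 2tanh(δ∕2)`) ·
  `nonempty_of_isProbabilityMeasure` · ★ `abs_integral_tilted_sub_integral_le_tanh` · `abs_measureReal_tilted_sub_le_tanh` · `abs_integral_tilted_sub_tilted_le_tanh`
  (two tilts of a finite non-zero law) · ★ `abs_tiltedMean_tilted_sub_le_tanh` (`|tiltedMean F (ν.tilted g) s − tiltedMean F ν s| ≤ 2B₀·tanh(δ∕2)`) ·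
  `abs_tiltedMean_tilted_sub_le_linear` (`≤ B₀·δ`).
* §3 [decided witness] ★ `sharp_two_point` — EQUALITY `= 2B·tanh(δ∕2)` on `Bool` (law `P(σ = 1) = 1∕(1 + e^{δ})`, tilt `δσ`, observable `Bσ`; n14-c's
  `integral_spin_tilted` BY NAME): the constant cannot be lowered · `abs_spin_mul_le`.

HONEST FRAMING.  Sharp [folklore] real ∕ measure inequalities (Mathlib `Measure.tilted`) bearing on HYPOTHESIS SHAPES — SHAPE_cl ∕ TV_cl are UNPRINTED
two-run statements for d = 4, produced by nobody; ZERO estimate content for Bałaban's runs; nothing of Bałaban's instantiated; NE1′ ∕ NE7 NOT PRINTED as two-run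
statements and NOT PROVED; N14 NOT discharged (DEPENDENT on §N19 s1 ∕ U3); K3⁷ OPEN, not claimed; counts UNMOVED (typed 28∕28 · discharged 5∕27, A 5∕28).
One finite 𝕋⁴ programme at fixed `ε`; the Yang–Mills mass gap (Clay) is NOT proved by any of this — R4 closes the conditional finite-𝕋⁴ rung
`BalabanLadder.UV` only; NOT ℝ⁴, NOT OS, NOT a mass gap.  0 `def`; 0 `sorry`; standard axioms; no decl below carries a cite tag.
-/

set_option autoImplicit false

noncomputable section

open MeasureTheory ProbabilityTheory
open scoped ENNReal

namespace YMDAG.N14.SharpTilt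

open Summit.QuantumFields.BalabanUV.T4Continuum.NE1p.DressedMGFForm (tiltedMean)

/-! ## §1 The real-variable core: the chord under `(ρ − 1)₊` and its value -/

section Reals

/-- **THE CHORD** [folklore]: on an interval `[a, b]` containing `1`, `|ρ − 1| ≤ 2λ·(ρ − a) − (ρ − 1)` with `λ = (b − 1)∕(b − a)` — i.e. the
positive part `(ρ − 1)₊` lies under the chord from `(a, 0)` to `(b, b − 1)` (and `|x| = 2x₊ − x`).  Degenerate `a = b` (then `= 1 = ρ`) included
(`x ∕ 0 = 0`). -/
theorem abs_sub_one_le_chord {a b ρ : ℝ} (ha : a ≤ 1) (hb : 1 ≤ b) (hρa : a ≤ ρ) (hρb : ρ ≤ b) :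
    |ρ - 1| ≤ 2 * ((b - 1) / (b - a)) * (ρ - a) - (ρ - 1) := by
  rcases eq_or_lt_of_le (ha.trans hb) with hab | hab
  · -- `a = b = 1 = ρ`
    subst hab
    have ha1 : a = 1 := le_antisymm ha hb
    subst ha1
    have hρ1 : ρ = 1 := le_antisymm hρb hρa
    subst hρ1
    norm_num
  · have hba : 0 < b - a := sub_pos.mpr hab
    have hl : 0 ≤ (b - 1) / (b - a) := div_nonneg (sub_nonneg.mpr hb) hba.le
    rcases le_total ρ 1 with hρ1 | hρ1
    · rw [abs_of_nonpos (sub_nonpos.mpr hρ1)]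
      have : 0 ≤ 2 * ((b - 1) / (b - a)) * (ρ - a) := by
        have h2 : 0 ≤ ρ - a := sub_nonneg.mpr hρa
        positivity
      linarith
    · rw [abs_of_nonneg (sub_nonneg.mpr hρ1)]
      have key : ρ - 1 ≤ (b - 1) / (b - a) * (ρ - a) := by
        rw [div_mul_eq_mul_div, le_div_iff₀ hba]
        nlinarith [mul_nonneg (sub_nonneg.mpr ha) (sub_nonneg.mpr hρb)]
      linarith

/-- **THE CHORD's VALUE** [folklore]: at `b = a·u²` (`0 < a ≤ 1 ≤ a·u²`, `1 ≤ u`) the integrated chord `λ·(1 − a) = (au² − 1)(1 − a)∕(au² − a)` is at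
most `(u − 1)∕(u + 1)` — the difference is `(u + 1)(au − 1)² ≥ 0` after clearing denominators; equality at `a = u⁻¹`. -/
theorem chord_value_le {a u : ℝ} (ha0 : 0 < a) (hu : 1 ≤ u) (ha1 : a ≤ 1) (hb1 : 1 ≤ a * u ^ 2) :
    (a * u ^ 2 - 1) / (a * u ^ 2 - a) * (1 - a) ≤ (u - 1) / (u + 1) := by
  rcases eq_or_lt_of_le hu with hu1 | hu1
  · subst hu1
    have : a = 1 := le_antisymm ha1 (by simpa using hb1)
    subst this
    norm_num
  · have hden : 0 < a * u ^ 2 - a := by nlinarith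
    have hu1' : 0 < u + 1 := by linarith
    rw [div_mul_eq_mul_div, div_le_div_iff₀ hden hu1']
    nlinarith [mul_nonneg hu1'.le (sq_nonneg (a * u - 1)), mul_pos ha0 hu1']

/-- `tanh(δ∕2) = (e^{δ} − 1)∕(e^{δ} + 1)`. [folklore] -/
theorem tanh_half_eq_exp (δ : ℝ) : Real.tanh (δ / 2) = (Real.exp δ - 1) / (Real.exp δ + 1) := by
  rw [Real.tanh_eq]
  have h : Real.exp δ = Real.exp (δ / 2) * Real.exp (δ / 2) := by rw [← Real.exp_add]; ring_nf
  have hpos : 0 < Real.exp (δ / 2) := Real.exp_pos _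
  rw [Real.exp_neg, h]
  field_simp

/-- `0 ≤ tanh(δ∕2)` for `0 ≤ δ` (`Literature…WeakCouplingCeiling.tanh_nonneg` BY NAME). [folklore] -/
theorem tanh_half_nonneg {δ : ℝ} (hδ : 0 ≤ δ) : 0 ≤ Real.tanh (δ / 2) :=
  Literature.Barriers.HubbardSuperconductivity.tanh_nonneg (by linarith)

/-- **THE SHARP CONSTANT IMPLIES THE TREE's**: `2·tanh(δ∕2) ≤ e^{2δ} − 1` for `δ ≥ 0` (so every `2B·tanh(δ∕2)` bound below gives back n14-c J's
`B·(e^{2δ} − 1)`); the ratio is `2` at `δ → 0` and unbounded at `δ → ∞`. [folklore] -/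
theorem two_mul_tanh_half_le_exp_two_mul_sub_one {δ : ℝ} (hδ : 0 ≤ δ) : 2 * Real.tanh (δ / 2) ≤ Real.exp (2 * δ) - 1 := by
  rw [tanh_half_eq_exp]
  have hu : 1 ≤ Real.exp δ := Real.one_le_exp hδ
  have h2 : Real.exp (2 * δ) = Real.exp δ ^ 2 := by rw [← Real.exp_nat_mul]; norm_num
  have h3 : 0 ≤ (Real.exp δ - 1) * ((Real.exp δ + 1) ^ 2 - 2) := mul_nonneg (by linarith) (by nlinarith)
  rw [h2, mul_div_assoc', div_le_iff₀ (by linarith)]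
  nlinarith [h3]

end Reals

/-! ## §2 One probability law: the density `e^{g}∕Z`, its `L¹` distance to `1`, the tilted integrals, set masses, two tilts, tilted means -/

section OneLaw

variable {α : Type*} [MeasurableSpace α] {μ : Measure α} {g F : α → ℝ} {δ B : ℝ}

/-- For `|g| ≤ δ` on a probability space: `e^{−δ} ≤ ∫e^{g}dμ ≤ e^{δ}` (so `0 ≤ δ`). [folklore] -/
theorem exp_neg_le_integral_exp_le [IsProbabilityMeasure μ] (hgm : Measurable g) (hgb : ∀ x, |g x| ≤ δ) :
    Real.exp (-δ) ≤ ∫ x, Real.exp (g x) ∂μ ∧ ∫ x, Real.exp (g x) ∂μ ≤ Real.exp δ := by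
  have hint : Integrable (fun x => Real.exp (g x)) μ := by
    have := Literature.Probability.Moments.integrable_exp_mul_of_abs_le_const μ hgm hgb 1; simpa using this
  constructor
  · have h : ∫ _x, Real.exp (-δ) ∂μ ≤ ∫ x, Real.exp (g x) ∂μ :=
      integral_mono (integrable_const _) hint fun x => Real.exp_le_exp.2 (abs_le.1 (hgb x)).1
    simpa [integral_const, probReal_univ] using h
  · have h : ∫ x, Real.exp (g x) ∂μ ≤ ∫ _x, Real.exp δ ∂μ :=
      integral_mono hint (integrable_const _) fun x => Real.exp_le_exp.2 (abs_le.1 (hgb x)).2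
    simpa [integral_const, probReal_univ] using h

/-- ★ **THE `L¹` DISTANCE OF THE TILT DENSITY TO `1`** [folklore]: for a probability law `μ` and measurable `|g| ≤ δ`, the density
`ρ = e^{g}∕∫e^{g}dμ` of `μ.tilted g` satisfies `∫|ρ − 1|dμ ≤ 2·tanh(δ∕2)` — i.e. `TV(μ.tilted g, μ) ≤ tanh(δ∕2)`.  The chord (§1) integrated:
`ρ ∈ [a, a·e^{2δ}]` with `a = e^{−δ}∕Z ≤ 1 ≤ a·e^{2δ}`, `∫ρ dμ = 1`. -/
theorem integral_abs_density_sub_one_le [IsProbabilityMeasure μ] (hgm : Measurable g) (hgb : ∀ x, |g x| ≤ δ) :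
    ∫ x, |Real.exp (g x) / (∫ y, Real.exp (g y) ∂μ) - 1| ∂μ ≤ 2 * Real.tanh (δ / 2) := by
  obtain ⟨hZlo, hZhi⟩ := exp_neg_le_integral_exp_le (μ := μ) hgm hgb
  set Z : ℝ := ∫ y, Real.exp (g y) ∂μ with hZ
  have hZpos : 0 < Z := (Real.exp_pos _).trans_le hZlo
  have hint : Integrable (fun x => Real.exp (g x)) μ := by
    have := Literature.Probability.Moments.integrable_exp_mul_of_abs_le_const μ hgm hgb 1; simpa using this
  -- the interval `[a, a u²] ∋ 1` containing the density
  set a : ℝ := Real.exp (-δ) / Z with ha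
  set u : ℝ := Real.exp δ with hu
  have ha0 : 0 < a := div_pos (Real.exp_pos _) hZpos
  have hδ : 0 ≤ δ := by
    have := Real.exp_le_exp.1 (hZlo.trans hZhi); linarith
  have hu1 : 1 ≤ u := Real.one_le_exp hδ
  have hau : a * u ^ 2 = Real.exp δ / Z := by
    have h3 : Real.exp (-δ) * (Real.exp δ * Real.exp δ) = Real.exp δ := by
      rw [← Real.exp_add, ← Real.exp_add]; congr 1; ring
    rw [ha, hu, sq, div_mul_eq_mul_div, h3]
  have ha1 : a ≤ 1 := (div_le_one hZpos).2 hZlo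
  have hb1 : 1 ≤ a * u ^ 2 := by rw [hau]; exact (one_le_div hZpos).2 hZhi
  have hρa : ∀ x, a ≤ Real.exp (g x) / Z := fun x =>
    div_le_div_of_nonneg_right (Real.exp_le_exp.2 (abs_le.1 (hgb x)).1) hZpos.le
  have hρb : ∀ x, Real.exp (g x) / Z ≤ a * u ^ 2 := fun x => by
    rw [hau]; exact div_le_div_of_nonneg_right (Real.exp_le_exp.2 (abs_le.1 (hgb x)).2) hZpos.le
  -- integrate the chord
  set lam : ℝ := (a * u ^ 2 - 1) / (a * u ^ 2 - a) with hlam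
  have hρ_int : Integrable (fun x => Real.exp (g x) / Z) μ := hint.div_const Z
  have h1 : ∫ x, Real.exp (g x) / Z ∂μ = 1 := by
    rw [integral_div, ← hZ]; exact div_self hZpos.ne'
  have i1 : Integrable (fun x => 2 * lam * (Real.exp (g x) / Z - a)) μ := (hρ_int.sub (integrable_const a)).const_mul (2 * lam)
  have i2 : Integrable (fun x => Real.exp (g x) / Z - 1) μ := hρ_int.sub (integrable_const 1)
  have hrhs_int : Integrable (fun x => 2 * lam * (Real.exp (g x) / Z - a) - (Real.exp (g x) / Z - 1)) μ := i1.sub i2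
  have hrhs : ∫ x, (2 * lam * (Real.exp (g x) / Z - a) - (Real.exp (g x) / Z - 1)) ∂μ = 2 * lam * (1 - a) := by
    rw [integral_sub i1 i2, integral_const_mul, integral_sub hρ_int (integrable_const a),
      integral_sub hρ_int (integrable_const 1), h1]
    simp [integral_const, probReal_univ]
  have habs_int : Integrable (fun x => |Real.exp (g x) / Z - 1|) μ := i2.abs
  calc ∫ x, |Real.exp (g x) / Z - 1| ∂μ
      ≤ ∫ x, (2 * lam * (Real.exp (g x) / Z - a) - (Real.exp (g x) / Z - 1)) ∂μ :=
        integral_mono habs_int hrhs_int fun x => abs_sub_one_le_chord ha1 hb1 (hρa x) (hρb x)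
    _ = 2 * (lam * (1 - a)) := by rw [hrhs]; ring
    _ ≤ 2 * ((u - 1) / (u + 1)) := by
        have := chord_value_le ha0 hu1 ha1 hb1
        rw [← hlam] at this
        linarith
    _ = 2 * Real.tanh (δ / 2) := by rw [tanh_half_eq_exp]

/-- A probability law lives on an inhabited carrier. [bookkeeping] -/
theorem nonempty_of_isProbabilityMeasure (μ : Measure α) [IsProbabilityMeasure μ] : Nonempty α := by
  obtain ⟨x, -⟩ := nonempty_of_measure_ne_zero (μ := μ) (s := Set.univ) (by simp)
  exact ⟨x⟩

/-- ★ **THE SHARP TILT DEFECT** [folklore]: for a probability law `μ`, a measurable tilt `|g| ≤ δ` and a measurable observable `|F| ≤ B`,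
`|∫F d(μ.tilted g) − ∫F dμ| ≤ 2B·tanh(δ∕2)` (`≤ B·δ`, `≤ 2B`).  Attained (§3).  The tree's constant `B·(e^{2δ} − 1)` follows
(`two_mul_tanh_half_le_exp_two_mul_sub_one`). -/
theorem abs_integral_tilted_sub_integral_le_tanh [IsProbabilityMeasure μ] (hgm : Measurable g) (hgb : ∀ x, |g x| ≤ δ)
    (hFm : Measurable F) (hFb : ∀ x, |F x| ≤ B) :
    |∫ x, F x ∂(μ.tilted g) - ∫ x, F x ∂μ| ≤ 2 * B * Real.tanh (δ / 2) := by
  obtain ⟨x₀⟩ := nonempty_of_isProbabilityMeasure μ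
  have hB : 0 ≤ B := (abs_nonneg _).trans (hFb x₀)
  have hZpos : 0 < ∫ y, Real.exp (g y) ∂μ := (Real.exp_pos _).trans_le (exp_neg_le_integral_exp_le (μ := μ) hgm hgb).1
  set ρ : α → ℝ := fun x => Real.exp (g x) / ∫ y, Real.exp (g y) ∂μ with hρ
  have hint : Integrable (fun x => Real.exp (g x)) μ := by
    have := Literature.Probability.Moments.integrable_exp_mul_of_abs_le_const μ hgm hgb 1; simpa using this
  have hF_int : Integrable F μ :=
    (integrable_const B).mono' hFm.aestronglyMeasurable (ae_of_all _ fun x => by rw [Real.norm_eq_abs]; exact hFb x)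
  have hρ_bdd : ∀ x, |ρ x| ≤ Real.exp δ / ∫ y, Real.exp (g y) ∂μ := fun x => by
    rw [hρ, abs_of_nonneg (div_nonneg (Real.exp_pos _).le hZpos.le)]
    exact div_le_div_of_nonneg_right (Real.exp_le_exp.2 (abs_le.1 (hgb x)).2) hZpos.le
  have hρm : Measurable ρ := hgm.exp.div_const _
  have hρF_int : Integrable (fun x => ρ x * F x) μ := by
    refine (integrable_const ((Real.exp δ / ∫ y, Real.exp (g y) ∂μ) * B)).mono' (hρm.mul hFm).aestronglyMeasurable
      (ae_of_all _ fun x => ?_)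
    rw [Real.norm_eq_abs, abs_mul]
    exact mul_le_mul (hρ_bdd x) (hFb x) (abs_nonneg _) (div_nonneg (Real.exp_pos _).le hZpos.le)
  have hρ_int : Integrable ρ μ := hint.div_const _
  rw [integral_tilted]
  simp only [smul_eq_mul]
  change |(∫ x, ρ x * F x ∂μ) - ∫ x, F x ∂μ| ≤ _
  rw [← integral_sub hρF_int hF_int]
  have habs_int : Integrable (fun x => |ρ x - 1|) μ := (hρ_int.sub (integrable_const 1)).abs
  calc |∫ x, (ρ x * F x - F x) ∂μ|
      ≤ ∫ x, |ρ x * F x - F x| ∂μ := abs_integral_le_integral_abs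
    _ ≤ ∫ x, |ρ x - 1| * B ∂μ := by
        refine integral_mono_of_nonneg (ae_of_all _ fun x => abs_nonneg _) (habs_int.mul_const B) (ae_of_all _ fun x => ?_)
        dsimp only
        rw [show ρ x * F x - F x = (ρ x - 1) * F x by ring, abs_mul]
        exact mul_le_mul_of_nonneg_left (hFb x) (abs_nonneg _)
    _ = (∫ x, |ρ x - 1| ∂μ) * B := integral_mul_const B _
    _ ≤ 2 * Real.tanh (δ / 2) * B := mul_le_mul_of_nonneg_right (integral_abs_density_sub_one_le hgm hgb) hB
    _ = 2 * B * Real.tanh (δ / 2) := by ring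

/-- **SET MASSES** [folklore]: `|(μ.tilted g)(S) − μ(S)| ≤ tanh(δ∕2)` on every measurable set — the total-variation form (test function
`1_S − ½`, bound `½`). -/
theorem abs_measureReal_tilted_sub_le_tanh [IsProbabilityMeasure μ] (hgm : Measurable g) (hgb : ∀ x, |g x| ≤ δ) {S : Set α}
    (hS : MeasurableSet S) : |(μ.tilted g).real S - μ.real S| ≤ Real.tanh (δ / 2) := by
  have hint : Integrable (fun x => Real.exp (g x)) μ := by
    have := Literature.Probability.Moments.integrable_exp_mul_of_abs_le_const μ hgm hgb 1; simpa using this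
  haveI : IsProbabilityMeasure (μ.tilted g) := isProbabilityMeasure_tilted hint
  have hFb : ∀ x, |S.indicator (1 : α → ℝ) x - 1 / 2| ≤ 1 / 2 := fun x => by
    by_cases hx : x ∈ S
    · rw [Set.indicator_of_mem hx]; norm_num
    · rw [Set.indicator_of_notMem hx]; norm_num
  have hFm : Measurable fun x => S.indicator (1 : α → ℝ) x - 1 / 2 :=
    (measurable_one.indicator hS).sub measurable_const
  have key := abs_integral_tilted_sub_integral_le_tanh (μ := μ) (F := fun x => S.indicator (1 : α → ℝ) x - 1 / 2) hgm hgb hFm hFb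
  have i1 : ∀ (ν : Measure α) [IsProbabilityMeasure ν], Integrable (S.indicator (1 : α → ℝ)) ν := fun ν _ =>
    (integrable_const (1 : ℝ)).indicator hS
  have hev : ∀ (ν : Measure α) [IsProbabilityMeasure ν], ∫ x, (S.indicator (1 : α → ℝ) x - 1 / 2) ∂ν = ν.real S - 1 / 2 := by
    intro ν _
    rw [integral_sub (i1 ν) (integrable_const _), integral_indicator_one hS]
    simp [integral_const, probReal_univ]
  rw [hev, hev] at key
  have e : (μ.tilted g).real S - 1 / 2 - (μ.real S - 1 / 2) = (μ.tilted g).real S - μ.real S := by ring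
  rw [e] at key
  linarith

/-- **TWO TILTS OF ONE FINITE LAW** [folklore]: `ν ≠ 0` finite, `g₁, g₂` measurable, `g₂` bounded, `|g₁ − g₂| ≤ δ`, `|F| ≤ B` measurable:
`|∫F d(ν.tilted g₁) − ∫F d(ν.tilted g₂)| ≤ 2B·tanh(δ∕2)` (`ν.tilted g₁ = (ν.tilted g₂).tilted (g₁ − g₂)`, Mathlib `tilted_tilted`).  Sharpens n14-c's
`abs_integral_tilted_sub_tilted_le` (`B·(e^{2δ} − 1)`). -/
theorem abs_integral_tilted_sub_tilted_le_tanh {ν : Measure α} [IsFiniteMeasure ν] [NeZero ν] {g₁ g₂ : α → ℝ} {δ₂ : ℝ}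
    (hg₁m : Measurable g₁) (hg₂m : Measurable g₂) (hg₂b : ∀ x, |g₂ x| ≤ δ₂) (hd : ∀ x, |g₁ x - g₂ x| ≤ δ)
    (hFm : Measurable F) (hFb : ∀ x, |F x| ≤ B) :
    |∫ x, F x ∂(ν.tilted g₁) - ∫ x, F x ∂(ν.tilted g₂)| ≤ 2 * B * Real.tanh (δ / 2) := by
  have hint₂ : Integrable (fun x => Real.exp (g₂ x)) ν := by
    have := Literature.Probability.Moments.integrable_exp_mul_of_abs_le_const ν hg₂m hg₂b 1; simpa using this
  haveI : IsProbabilityMeasure (ν.tilted g₂) := isProbabilityMeasure_tilted hint₂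
  have h : ν.tilted g₁ = (ν.tilted g₂).tilted (fun x => g₁ x - g₂ x) := by
    rw [tilted_tilted hint₂]
    congr 1
    funext x
    simp
  rw [h]
  exact abs_integral_tilted_sub_integral_le_tanh (μ := ν.tilted g₂) (hg₁m.sub hg₂m) hd hFm hFb

/-- ★ **THE SHARP TILT DEFECT IN N14's LETTERS** [folklore]: `ν ≠ 0` finite, `|g| ≤ δ` and `|F| ≤ B₀` measurable, every tilt `s`:
`|tiltedMean F (ν.tilted g) s − tiltedMean F ν s| ≤ 2B₀·tanh(δ∕2)` — the sharp form of n14-c J `ConvexFibreConsistency.abs_tiltedMean_tilted_sub_le`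
(`B₀·(e^{2δ} − 1)`); the source tilt `sF` is absorbed into the law (`(ν.tilted g).tilted (sF) = ν.tilted (g + sF)`). -/
theorem abs_tiltedMean_tilted_sub_le_tanh {ν : Measure α} [IsFiniteMeasure ν] [NeZero ν] (hgm : Measurable g) (hgb : ∀ x, |g x| ≤ δ)
    (hFm : Measurable F) {B₀ : ℝ} (hFb : ∀ x, |F x| ≤ B₀) (s : ℝ) :
    |tiltedMean F (ν.tilted g) s - tiltedMean F ν s| ≤ 2 * B₀ * Real.tanh (δ / 2) := by
  have hgi : Integrable (fun x => Real.exp (g x)) ν := by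
    have := Literature.Probability.Moments.integrable_exp_mul_of_abs_le_const ν hgm hgb 1; simpa using this
  rw [tiltedMean, tiltedMean, tilted_tilted hgi]
  have hsFb : ∀ x, |s * F x| ≤ |s| * B₀ := fun x => by rw [abs_mul]; exact mul_le_mul_of_nonneg_left (hFb x) (abs_nonneg s)
  exact abs_integral_tilted_sub_tilted_le_tanh (ν := ν) (hgm.add (hFm.const_mul s)) (hFm.const_mul s) hsFb
    (fun x => by simp only [Pi.add_apply, add_sub_cancel_right]; exact hgb x) hFm hFb

/-- **… AT THE LINEAR RATE** [folklore]: `≤ B₀·δ` (`tanh x ≤ x`, `Literature…WeakCouplingCeiling.tanh_le_self` BY NAME). -/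
theorem abs_tiltedMean_tilted_sub_le_linear {ν : Measure α} [IsFiniteMeasure ν] [NeZero ν] (hgm : Measurable g) (hgb : ∀ x, |g x| ≤ δ)
    (hFm : Measurable F) {B₀ : ℝ} (hFb : ∀ x, |F x| ≤ B₀) (s : ℝ) :
    |tiltedMean F (ν.tilted g) s - tiltedMean F ν s| ≤ B₀ * δ := by
  obtain ⟨x₀, -⟩ := nonempty_of_measure_ne_zero (μ := ν) (s := Set.univ) (by simp [NeZero.ne])
  have hB : 0 ≤ B₀ := (abs_nonneg _).trans (hFb x₀)
  have hδ : 0 ≤ δ := (abs_nonneg _).trans (hgb x₀)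
  have ht : Real.tanh (δ / 2) ≤ δ / 2 := Literature.Barriers.HubbardSuperconductivity.tanh_le_self (by linarith)
  calc |tiltedMean F (ν.tilted g) s - tiltedMean F ν s| ≤ 2 * B₀ * Real.tanh (δ / 2) :=
        abs_tiltedMean_tilted_sub_le_tanh hgm hgb hFm hFb s
    _ ≤ 2 * B₀ * (δ / 2) := mul_le_mul_of_nonneg_left ht (by positivity)
    _ = B₀ * δ := by ring

end OneLaw

/-! ## §3 The constant is attained: the two-point law -/

section Witness

/-- ★ **SHARPNESS** [decided witness]: on `{±1}` take the law `P(σ = 1) = 1∕(1 + e^{δ})` (the uniform law tilted by `−(δ∕2)σ`), the tilt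
`g = δσ` (`|g| = |δ|`) and the observable `F = Bσ` (`|F| = |B|`); then `∫F d(μ.tilted g) − ∫F dμ = B·tanh(δ∕2) − B·tanh(−δ∕2) = 2B·tanh(δ∕2)` —
EQUALITY in `abs_integral_tilted_sub_integral_le_tanh`, so the constant `2·tanh(δ∕2)` cannot be lowered (and `TV = tanh(δ∕2)` at `B = ½`).  n14-c's
`LawChannelTunedPathToy.integral_spin_tilted` (`∫σ d(unif.tilted(aσ)) = tanh a`) BY NAME. -/
theorem sharp_two_point (δ B : ℝ) :
    ∫ b, B * (if b then (1 : ℝ) else -1)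
        ∂((((2 : ℝ≥0∞)⁻¹ • (Measure.count : Measure Bool)).tilted fun b => -(δ / 2) * (if b then (1 : ℝ) else -1)).tilted
          fun b => δ * (if b then (1 : ℝ) else -1)) -
      ∫ b, B * (if b then (1 : ℝ) else -1)
        ∂(((2 : ℝ≥0∞)⁻¹ • (Measure.count : Measure Bool)).tilted fun b => -(δ / 2) * (if b then (1 : ℝ) else -1)) =
      2 * B * Real.tanh (δ / 2) := by
  haveI : IsProbabilityMeasure ((2 : ℝ≥0∞)⁻¹ • (Measure.count : Measure Bool)) :=
    LawChannelTunedPathToy.isProbabilityMeasure_uniform_bool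
  have hint : Integrable (fun b : Bool => Real.exp (-(δ / 2) * (if b then (1 : ℝ) else -1)))
      ((2 : ℝ≥0∞)⁻¹ • (Measure.count : Measure Bool)) := Integrable.of_finite
  rw [tilted_tilted hint]
  have hsum : ((fun b : Bool => -(δ / 2) * (if b then (1 : ℝ) else -1)) + fun b => δ * (if b then (1 : ℝ) else -1)) =
      fun b : Bool => (δ / 2) * (if b then (1 : ℝ) else -1) := by
    funext b; simp only [Pi.add_apply]; ring
  rw [hsum, integral_const_mul, integral_const_mul, LawChannelTunedPathToy.integral_spin_tilted,
    LawChannelTunedPathToy.integral_spin_tilted, Real.tanh_neg]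
  ring

/-- The witness meets the hypotheses of §2 with the letters `|δ|`, `|B|`: `|c·σ| ≤ |c|` on `{±1}`. [bookkeeping] -/
theorem abs_spin_mul_le (c : ℝ) (b : Bool) : |c * (if b then (1 : ℝ) else -1)| ≤ |c| := by
  cases b <;> simp

end Witness

end YMDAG.N14.SharpTilt

end
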